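import Mathlib
import Summits.NavierStokesRegularity.NavierStokesRegularity.Theses.SymmetryModuliCount
import Literature.Analysis.FluidPDE.TypeIAncientMild

/-!
# Sketch — crux HelicalEndLiouville (stmt-NavierStokesRegularity-14062), ideator 2, round 1

Idea card `vanishing-cell-reynolds` ("far-past cell extinction"): a `L`-periodic element of
`A_C` has vanishing cell Reynolds number `Re_cell(t) = C‖L‖/√(−t) → 0` as `t → −∞`; the
cell-oscillation `w = u − Π₀u` (Π₀ = average over one period) solves a HOMOGENEOUS linear mild
equation whose Duhamel kernel, thanks to the Poincaré gap of the period cell, has total mass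
`≲ ‖L‖` in `L^∞ → L^∞`; hence `‖w(t)‖∞ ≤ κ·Re_cell(t)·sup_{τ≤t}‖w(τ)‖∞` and `w ≡ 0` on the end
`t < −(κ C ‖L‖)²`. There `u` is invariant under ALL translations along `L` (2.5-D) and the PROVED
tree theorem `KNSS2009_typeI_rate_liouville_holds` kills it; forward uniqueness
(`BackwardEndVanishing`, route support item) finishes. No compactness, no zoom-out, no limits.

The `First lemma:` of the card is `FarPastCellExtinction` below; the two analytic kernel facts it
rests on are `CellOscillationHeatBound` and `CellOscillationOseenBound`; the composition
`helicalEndLiouville_of_cellExtinction` is kernel-checked logic (no sorry).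
-/

namespace Summit.NavierStokesRegularity.NavierStokesRegularity.Cruxes.HelicalEndLiouville.CellExtinction

open MeasureTheory Set
open Literature.Analysis.FluidPDE
set_option linter.dupNamespace false

/-- `ℝ³`. -/
abbrev E3 : Type := EuclideanSpace ℝ (Fin 3)

/-- VERBATIM copy of the crux `SymmetryModuliCount.HelicalEndLiouville` (stmt-14062; the farm's
copy of the route module predates rev 5, so the decl is restated here letter for letter from the
item's `signature`). -/
def HelicalEndLiouville' : Prop :=
  ∀ (C : ℝ) (u : ℝ → EuclideanSpace ℝ (Fin 3) → EuclideanSpace ℝ (Fin 3)), Literature.Analysis.FluidPDE.IsTypeIAncientMild C u → ∀ (a : EuclideanSpace ℝ (Fin 3)) (A : EuclideanSpace ℝ (Fin 3) →L[ℝ] EuclideanSpace ℝ (Fin 3)) (θ : ℝ), (∀ x, inner ℝ (A x) x = 0) → a ∉ Set.range A → θ ≤ 0 → (∀ t < θ, ∀ x, fderiv ℝ (u t) x (a + A x) - A (u t x) = 0) → ∀ t < θ, ∀ x, u t x = 0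

/-- VERBATIM copy of the route's support item `SymmetryModuliCount.BackwardEndVanishing`
(stmt-14064). -/
def BackwardEndVanishing' : Prop :=
  ∀ (C : ℝ) (u : ℝ → EuclideanSpace ℝ (Fin 3) → EuclideanSpace ℝ (Fin 3)), Literature.Analysis.FluidPDE.IsTypeIAncientMild C u → ∀ θ : ℝ, θ ≤ 0 → (∀ t < θ, ∀ x, u t x = 0) → ∀ t < 0, ∀ x, u t x = 0

/-- Cell average along the period vector `L`: `Π₀ f (x) = ∫₀¹ f (x + s • L) ds`
(for an `L`-periodic `f` this is the projection onto `L`-translation-invariant functions; it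
commutes with every translation-invariant operator: heat flow, Oseen kernel, Riesz transforms). -/
noncomputable def cellMean {F : Type*} [NormedAddCommGroup F] [NormedSpace ℝ F]
    (L : E3) (f : E3 → F) (x : E3) : F :=
  ∫ s in Icc (0 : ℝ) 1, f (x + s • L)

/-- **First lemma (the lever): FAR-PAST CELL EXTINCTION.** There is an absolute `κ > 0` such
that every `u ∈ A_C` (`IsTypeIAncientMild C u`) which is `L`-periodic (`L ≠ 0`) on a backward end
`t < θ` (`θ ≤ 0`) is invariant under ALL translations along `L` on the deeper end
`t < min θ (−(κ C ‖L‖)²)`. Proof sketch: `w := u − Π₀u` satisfies, for `s < t < θ`,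
`w(t) = (I−Π₀)e^{(t−s)Δ}u(s) − ∫ₛᵗ (I−Π₀)e^{(t−τ)Δ}P∇·F(τ)dτ` with
`F = u⊗u − Π₀u⊗Π₀u = Π₀u⊗w + w⊗Π₀u + w⊗w`, `‖F(τ)‖∞ ≤ 4‖u(τ)‖∞‖w(τ)‖∞`;
`CellOscillationHeatBound` kills the first term as `s → −∞` (`≲ ‖L‖²(t−s)⁻¹·C(−s)^{-1/2}`),
`CellOscillationOseenBound` bounds the kernel by `κ' min((t−τ)^{-1/2}, ‖L‖²(t−τ)^{-3/2})`, of
total mass `≤ 6κ'‖L‖`; so `W(t) := sup_{τ≤t}‖w(τ)‖∞` (finite, `≤ 2C/√(−t)`) obeys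
`W(t) ≤ 24κ' C ‖L‖ (−t)^{-1/2} W(t)`, i.e. `W(t) = 0` once `√(−t) > 24κ'C‖L‖`. -/
def FarPastCellExtinction : Prop :=
  ∃ κ : ℝ, 0 < κ ∧ ∀ (C : ℝ) (u : ℝ → E3 → E3), IsTypeIAncientMild C u →
    ∀ (L : E3) (θ : ℝ), L ≠ 0 → θ ≤ 0 → (∀ t < θ, ∀ x, u t (x + L) = u t x) →
      ∀ t < min θ (-(κ * C * ‖L‖) ^ 2), ∀ (x : E3) (s : ℝ), u t (x + s • L) = u t x

/-- **Kernel fact 1 (Poincaré gap of the cell under the heat flow, derivative form).** For an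
`L`-periodic bounded continuous `g` and `σ > 0`:
`‖e^{σΔ}g − Π₀ e^{σΔ}g‖∞ ≤ κ ‖L‖² σ⁻¹ ‖g‖∞` — from the circle inequality
`‖h − Π₀h‖∞ ≤ (‖L‖²/4)‖∂_L² h‖∞` (a zero-mean periodic function and its derivative both vanish
somewhere) and the Gaussian bound `‖∂²G_σ‖_{L¹} = c/σ`. (Equivalent spectral form:
`Σ_{k≠0} e^{−4π²k²σ/‖L‖²}`.) -/
def CellOscillationHeatBound : Prop :=
  ∃ κ : ℝ, 0 < κ ∧ ∀ (L : E3), L ≠ 0 → ∀ (g : E3 → E3) (M σ : ℝ), Continuous g →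
    (∀ x, g (x + L) = g x) → (∀ x, ‖g x‖ ≤ M) → 0 < σ →
      ∀ x, ‖heatFlow g σ x - cellMean L (heatFlow g σ) x‖ ≤ κ * ‖L‖ ^ 2 / σ * M

/-- **Kernel fact 2 (cell-oscillation of one Oseen–Duhamel slice).** For `L`-periodic bounded
continuous `f, g` and `σ > 0`, the oscillating part of `x ↦ ∫ K(σ, x − y)[f y, g y] dy`
(`K = oseenKernel`, the kernel of `e^{σΔ}P∇·`) is bounded by
`κ · min(σ^{-1/2}, ‖L‖² σ^{-3/2}) · M_f M_g`: the first branch is the tree bound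
`exists_norm_oseenKernel_le` (mass `∼ σ^{-1/2}`), the second is the semigroup split
`K(σ) = e^{(σ/2)Δ}K(σ/2)` (tree `OseenKernelSemigroup`) followed by kernel fact 1. Its time
integral `∫₀^∞ min(σ^{-1/2}, ‖L‖²σ^{-3/2}) dσ = 4‖L‖` is the whole point: the oscillation only
remembers one cell-diffusion time `‖L‖²`. -/
def CellOscillationOseenBound : Prop :=
  ∃ κ : ℝ, 0 < κ ∧ ∀ (L : E3), L ≠ 0 → ∀ (f g : E3 → E3) (Mf Mg σ : ℝ), Continuous f →
    Continuous g → (∀ x, f (x + L) = f x) → (∀ x, g (x + L) = g x) → (∀ x, ‖f x‖ ≤ Mf) →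
    (∀ x, ‖g x‖ ≤ Mg) → 0 < σ →
      ∀ x, ‖(∫ y, oseenKernel σ (x - y) (f y) (g y)) -
          cellMean L (fun x' => ∫ y, oseenKernel σ (x' - y) (f y) (g y)) x‖ ≤
        κ * min (σ ^ (-(1 / 2 : ℝ))) (‖L‖ ^ 2 * σ ^ (-(3 / 2 : ℝ))) * Mf * Mg

/-- **2.5-D leaf on an end, direction-free** (= tree THEOREM `KNSS2009_typeI_rate_liouville_holds`
after a rotation taking `L` to `e₂` — rotation covariance of `IsTypeIAncientMild`, S — and the
shifts `u(· + T − δ)`, which are bounded by `C/√δ`, keep the class (`comp_sub_right`) and are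
translation-invariant for all `t < 0`). -/
def TranslationInvariantEndLiouville : Prop :=
  ∀ (C : ℝ) (u : ℝ → E3 → E3), IsTypeIAncientMild C u → ∀ (L : E3) (T : ℝ), L ≠ 0 → T ≤ 0 →
    (∀ t < T, ∀ (x : E3) (s : ℝ), u t (x + s • L) = u t x) → ∀ t < T, ∀ x, u t x = 0

/-- **Screw ⊃ lattice on an end** (shared with every line; S–M): a Killing generator `a + Ax`
(`A` skew, `a ∉ range A`) annihilating `u` on `t < θ` makes `u` periodic there with period
`L = (2π/ρ)·P_{ker A} a ≠ 0` (`L = a` if `A = 0`). -/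
def HelicalOrTranslationIsPeriodicEnd : Prop :=
  ∀ (C : ℝ) (u : ℝ → E3 → E3), IsTypeIAncientMild C u →
    ∀ (a : E3) (A : E3 →L[ℝ] E3) (θ : ℝ), (∀ x, inner ℝ (A x) x = 0) → a ∉ Set.range A → θ ≤ 0 →
      (∀ t < θ, ∀ x, fderiv ℝ (u t) x (a + A x) - A (u t x) = 0) →
        ∃ L : E3, L ≠ 0 ∧ ∀ t < θ, ∀ x, u t (x + L) = u t x

/-- **Shape check (pure logic, no sorry):** the four statements above, with the route's support
item `BackwardEndVanishing` (stmt-14064), give the crux `HelicalEndLiouville` BY NAME. -/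
theorem helicalEndLiouville_of_cellExtinction
    (hP : HelicalOrTranslationIsPeriodicEnd) (hE : FarPastCellExtinction)
    (hT : TranslationInvariantEndLiouville) (hB : BackwardEndVanishing') :
    HelicalEndLiouville' := by
  intro C u hu a A θ hA ha hθ hsym t ht x
  obtain ⟨L, hL0, hper⟩ := hP C u hu a A θ hA ha hθ hsym
  obtain ⟨κ, _hκ, hExt⟩ := hE
  set T : ℝ := min θ (-(κ * C * ‖L‖) ^ 2) with hTdef
  have hT0 : T ≤ 0 := (min_le_left _ _).trans hθ
  have hinv : ∀ t < T, ∀ (x : E3) (s : ℝ), u t (x + s • L) = u t x :=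
    hExt C u hu L θ hL0 hθ hper
  have hzero : ∀ t < T, ∀ x, u t x = 0 := hT C u hu L T hL0 hT0 hinv
  exact hB C u hu T hT0 hzero t (lt_of_lt_of_le ht hθ) x

/-- **Transfer C⁺ (small-cell-Reynolds rigidity in the BOUNDED ancient class):** there is an
absolute `ε₀ > 0` such that every bounded ancient Oseen-mild field on `ℝ³ × (−∞,0)` which is
`L`-periodic with `sup‖u‖ · ‖L‖ ≤ ε₀` is invariant under all translations along `L`. Same proof
(the contraction constant is `κ·sup‖u‖·‖L‖`); the crux's class meets the smallness on every end
`t < −(C‖L‖/ε₀)²` by the Type-I rate. Stated over `IsTypeIAncientMild` with an explicit bound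
to stay inside tree vocabulary. -/
def SmallCellReynoldsRigidity : Prop :=
  ∃ ε₀ : ℝ, 0 < ε₀ ∧ ∀ (C : ℝ) (u : ℝ → E3 → E3), IsTypeIAncientMild C u →
    ∀ (L : E3) (θ M : ℝ), L ≠ 0 → θ ≤ 0 → (∀ t < θ, ∀ x, ‖u t x‖ ≤ M) → M * ‖L‖ ≤ ε₀ →
      (∀ t < θ, ∀ x, u t (x + L) = u t x) → ∀ t < θ, ∀ (x : E3) (s : ℝ), u t (x + s • L) = u t x

/-- The Transfer implies the First lemma (with `κ = 1/ε₀`): on `t < min θ (−(C‖L‖/ε₀)²)` the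
Type-I rate gives `‖u‖ ≤ C/√(−t) ≤ ε₀/‖L‖`. Pure bookkeeping, kernel-checked. -/
theorem farPastCellExtinction_of_smallCellReynolds (h : SmallCellReynoldsRigidity) :
    FarPastCellExtinction := by
  obtain ⟨ε₀, hε₀, h⟩ := h
  refine ⟨1 / ε₀, by positivity, ?_⟩
  intro C u hu L θ hL0 hθ hper t ht x s
  set T : ℝ := min θ (-(1 / ε₀ * C * ‖L‖) ^ 2) with hTdef
  have hTθ : T ≤ θ := min_le_left _ _
  have hT0 : T ≤ 0 := hTθ.trans hθ
  have hC : 0 ≤ C := hu.nonneg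
  have hLpos : 0 < ‖L‖ := norm_pos_iff.2 hL0
  -- the bound `M = ε₀/‖L‖` on the end `t < T`
  have hM : ∀ t < T, ∀ x, ‖u t x‖ ≤ ε₀ / ‖L‖ := by
    intro τ hτ y
    have hτ0 : τ < 0 := lt_of_lt_of_le hτ hT0
    have hτ2 : τ < -(1 / ε₀ * C * ‖L‖) ^ 2 := lt_of_lt_of_le hτ (min_le_right _ _)
    have key := hu.norm_le hτ0 y
    refine key.trans ?_
    have hsq : (1 / ε₀ * C * ‖L‖) ^ 2 < -τ := by linarith
    have hnn : 0 ≤ 1 / ε₀ * C * ‖L‖ := by positivity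
    have hsqrt : 1 / ε₀ * C * ‖L‖ < Real.sqrt (-τ) := by
      calc 1 / ε₀ * C * ‖L‖ = Real.sqrt ((1 / ε₀ * C * ‖L‖) ^ 2) := (Real.sqrt_sq hnn).symm
        _ < Real.sqrt (-τ) := Real.sqrt_lt_sqrt (sq_nonneg _) hsq
    have hspos : 0 < Real.sqrt (-τ) := Real.sqrt_pos.2 (by linarith)
    rw [div_le_div_iff₀ hspos hLpos]
    have : C * ‖L‖ ≤ ε₀ * Real.sqrt (-τ) := by
      have h1 : C * ‖L‖ = ε₀ * (1 / ε₀ * C * ‖L‖) := by field_simp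
      rw [h1]
      exact mul_le_mul_of_nonneg_left hsqrt.le hε₀.le
    linarith
  have hsmall : ε₀ / ‖L‖ * ‖L‖ ≤ ε₀ := by
    rw [div_mul_cancel₀ _ hLpos.ne']
  exact h C u hu L T (ε₀ / ‖L‖) hL0 hT0 hM hsmall (fun τ hτ y => hper τ (lt_of_lt_of_le hτ hTθ) y)
    t ht x s

end Summit.NavierStokesRegularity.NavierStokesRegularity.Cruxes.HelicalEndLiouville.CellExtinction
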